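import Summits.BirchSwinnertonDyer.Rank1Residual.Additive.ZpTowerPlaceCount
import Summits.BirchSwinnertonDyer.Rank1Residual.X11b.AnticyclotomicLocalTowerTorsion
import Summits.BirchSwinnertonDyer.Rank1Residual.X11b.CoinvariantsLocal
import Literature.NumberTheory.EllipticCurves.ZpExtensionUnramifiedProofs
import Literature.NumberTheory.GaloisRepresentations.DecompositionGroupOfCompletion
import Literature.Barriers.BirchSwinnertonDyer.DescentDefectUnboundedMatsunoCor33Proofs
import HarnessLib

/-!
# Two facts about the layers `K_m` at a tame place `v`: `E[p^k]^{Γ_m ∩ D_v} = E(K_{∞,η})[p^k]` for `m ≫ 0`, and at least `p^c` places of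
# `K_m` over `v` when `p^c ∣ κ(D_v)` (crux ♭T≤ stmt-BirchSwinnertonDyer-23042, line `sigmacongruence`, stub R1 `stub_relaxedImageCount`, brick (e′))

Route `UniversalToricDescent`, lead prover `bsd-wall-utd-p1` g18. THEOREMS ONLY (no definition, no named fact, no `sorry`);
`--supports stmt-BirchSwinnertonDyer-23042`. BSD is not proved by any of this.

* `exists_natCard_fixed_layer_inf_decomp_eq` — for each `k` there is `m₁` with, for all `m ≥ m₁`,
  `#{a ∈ E[p^k] | (Γ_m ∩ D_v)·a = a} = #{a ∈ E[p^∞] | ker(κ|D_v)·a = a, p^k a = 0}` (the finite set on the right is fixed by some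
  `Γ_{m₁} ∩ D_v`, `X11b.AcSelmer.exists_layerSubgroup_inf_le_stabilizer`).
* `pow_le_natCard_placesOver_layer` — if `v ∤ p` and `p^c ∣ κ(d)` for all `d ∈ D_v`, then `K_m` has at least `p^c` places over `v` for
  `m ≥ c`: `v` is unramified in `K_∞` (`ZpExtension.inertia_le_kerSubgroup_holds`), an arithmetic Frobenius `σ` at the chosen prime lies in
  `D_v`, so `κ(σ) = p^{m'}·u` with `m' ≥ c` (or `κ(σ) = 1`), and `#{w ∣ v} = p^{min(m, m')}` (`ZpTower.card_placesOver_layer_mul_pow_eq`).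

References: [Washington1997] §13.1, Prop. 13.2; [NeukirchANT1999] I.§9 Prop. (9.4); [GreenbergLNM1716] §3 (p. 86).
-/

set_option linter.dupNamespace false
set_option autoImplicit false

noncomputable section
open scoped Classical
open CategoryTheory Field NumberField IsDedekindDomain Function
open Literature.NumberTheory.EllipticCurves Literature.NumberTheory.EllipticCurves.GreenbergSelmer
open Literature.NumberTheory.GaloisRepresentations
open scoped NumberField.LiesOver

namespace Summit.BirchSwinnertonDyer.BirchSwinnertonDyer.Theorems.UniversalToricDescentRelaxedLayerPlaces

open Summit.BirchSwinnertonDyer.Rank1Residual.X11b.AcSelmer Summit.BirchSwinnertonDyer.Rank1Residual.X11b.Coinv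
  Summit.BirchSwinnertonDyer.Rank1Residual.Additive.ZpTower

variable {K : Type} [Field K] [NumberField K] (W : WeierstrassCurve K) [W.IsElliptic] (p : ℕ) [Fact p.Prime]
  (κ : ZpExtension K p) (v : HeightOneSpectrum (𝓞 K))

/-! ## §1 `E[p^k]^{Γ_m ∩ D_v} = E(K_{∞,η})[p^k]` for `m ≫ 0` -/

/-- **For `m ≥ m₁(k)`: `#{a ∈ E[p^k] | (Γ_m ∩ D_v)·a = a} = #{a ∈ E[p^∞] | ker(κ|D_v)·a = a ∧ p^k a = 0}`.**
`⊆` always (`ker κ ∩ D_v ≤ Γ_m ∩ D_v`); the finite right-hand set is fixed pointwise by `Γ_{m₁} ∩ D_v` for some `m₁`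
(compactness, `X11b.AcSelmer.exists_layerSubgroup_inf_le_stabilizer`). [cite: GreenbergLNM1716, §3 (p. 86)] [cite: Washington1997, §13.1] -/
theorem exists_natCard_fixed_layer_inf_decomp_eq (k : ℕ) :
    ∃ m₁ : ℕ, ∀ m : ℕ, m₁ ≤ m →
      Nat.card {a : W.geomTorsion ((p ^ k : ℕ) : ℤ) // ∀ g ∈ κ.layerSubgroup m ⊓ decomp v, g • a = a} =
        Nat.card {a : W.geomPrimaryTorsion p //
          (∀ g : kerD κ v, ((g : decomp (K := K) v) : absoluteGaloisGroup K) • a = a) ∧ p ^ k • a = 0} := by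
  classical
  -- the finite set on the right, and a layer fixing it pointwise
  set A₀ : Set (W.geomPrimaryTorsion p) := {a | (∀ g ∈ decomp v ⊓ κ.kerSubgroup, g • a = a) ∧ p ^ k • a = 0} with hA₀
  have hA₀fin : A₀.Finite :=
    (finite_setOf_geomPrimaryTorsion_pow_smul_eq_zero (p := p) W (Fact.out : p.Prime).ne_zero k).subset fun a ha ↦ ha.2
  obtain ⟨m₁, hm₁⟩ := exists_layerSubgroup_inf_le_stabilizer κ (decomp v) (isClosed_decomp v)
    (W.continuous_smul_geomPrimaryTorsion p) hA₀fin (fun a ha g hg ↦ ha.1 g hg)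
  refine ⟨m₁, fun m hm ↦ ?_⟩
  have hle : W.geomTorsion ((p ^ k : ℕ) : ℤ) ≤ W.geomPrimaryTorsion p :=
    Literature.Barriers.BirchSwinnertonDyer.geomTorsion_pow_le_geomPrimaryTorsion W p k
  refine Nat.card_congr
    { toFun := fun a ↦ ⟨AddSubgroup.inclusion hle a.1, fun g ↦ ?_, ?_⟩
      invFun := fun b ↦ ⟨⟨(b.1 : W.geomPoints), ?_⟩, fun g hg ↦ ?_⟩
      left_inv := fun a ↦ Subtype.ext (Subtype.ext rfl)
      right_inv := fun b ↦ Subtype.ext (Subtype.ext rfl) }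
  · -- fixed by `ker κ ∩ D_v`
    apply Subtype.ext
    have hg : ((g : decomp (K := K) v) : absoluteGaloisGroup K) ∈ κ.layerSubgroup m ⊓ decomp v :=
      Subgroup.mem_inf.mpr ⟨κ.kerSubgroup_le_layerSubgroup m ((mem_kerD_iff κ v _).mp g.2), (g : decomp (K := K) v).2⟩
    have h := congrArg (fun x : W.geomTorsion ((p ^ k : ℕ) : ℤ) ↦ (x : W.geomPoints)) (a.2 _ hg)
    simp only [AddSubgroup.torsionBy.coe_smul] at h
    rw [Literature.NumberTheory.EllipticCurves.primaryComponent.coe_smul]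
    exact h
  · -- killed by `p^k`
    apply Subtype.ext
    rw [AddSubgroupClass.coe_nsmul, AddSubgroup.coe_inclusion, ← AddSubgroupClass.coe_nsmul, AddSubgroup.torsionBy.nsmul]
    rfl
  · -- `b ∈ E[p^k]`
    have h := congrArg (fun x : W.geomPrimaryTorsion p ↦ (x : W.geomPoints)) b.2.2
    simp only [AddSubgroupClass.coe_nsmul, ZeroMemClass.coe_zero] at h
    exact AddSubgroup.torsionBy.nsmul_iff.mpr (by rw [← AddSubgroupClass.coe_nsmul, b.2.2, ZeroMemClass.coe_zero])
  · -- fixed by `Γ_m ∩ D_v`, `m ≥ m₁`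
    apply Subtype.ext
    obtain ⟨hgm, hgD⟩ := Subgroup.mem_inf.mp hg
    have hb : b.1 ∈ A₀ := ⟨fun g' hg' ↦ by
      obtain ⟨hg'D, hg'k⟩ := Subgroup.mem_inf.mp hg'
      exact b.2.1 ⟨⟨g', hg'D⟩, (mem_kerD_iff κ v _).mpr hg'k⟩, b.2.2⟩
    have h := hm₁ g (Subgroup.mem_inf.mpr ⟨hgD, κ.layerSubgroup_antitone hm hgm⟩) b.1 hb
    have h' := congrArg (fun x : W.geomPrimaryTorsion p ↦ (x : W.geomPoints)) h
    simp only [Literature.NumberTheory.EllipticCurves.primaryComponent.coe_smul] at h'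
    rw [AddSubgroup.torsionBy.coe_smul]
    exact h'

/-! ## §2 At least `p^c` places of `K_m` over `v` -/

/-- **`p^c ≤ #{w ∣ v in K_m}` for `m ≥ c`**, when `v ∤ p` and `p^c ∣ κ(d)` for every `d ∈ D_v` (module docstring).
[cite: Washington1997, §13.1, Prop. 13.2] [cite: NeukirchANT1999, Ch. I §9 Prop. (9.4)] -/
theorem pow_le_natCard_placesOver_layer (hpv : ((p : ℕ) : 𝓞 K) ∉ v.asIdeal) {c : ℕ}
    (hdvd : ∀ d : decomp (K := K) v, (p : ℤ_[p]) ^ c ∣ (κ (d : absoluteGaloisGroup K)).toAdd) {m : ℕ} (hcm : c ≤ m) :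
    p ^ c ≤ Nat.card {w : HeightOneSpectrum (𝓞 (κ.layer m)) // w.under (𝓞 K) = v} := by
  classical
  have hprime : p.Prime := Fact.out
  set 𝔓 := adicCompletionPrime K v with h𝔓def
  have h𝔓 : 𝔓 ∈ v.primesAbove := adicCompletionPrime_mem_primesAbove K v
  have hI : 𝔓.inertia (absoluteGaloisGroup K) ≤ κ.kerSubgroup := ZpExtension.inertia_le_kerSubgroup_holds K p κ hpv h𝔓
  obtain ⟨σ, hσ⟩ := HeightOneSpectrum.exists_isArithFrobAt_of_mem_primesAbove_holds h𝔓
  -- `σ ∈ D_v`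
  have hσD : σ ∈ decomp (K := K) v := by
    have h := hσ.mem_stabilizer
    change σ ∈ 𝔓.decompositionSubgroup (absoluteGaloisGroup K) at h
    rw [h𝔓def, decompositionSubgroup_adicCompletionPrime_eq_range] at h
    exact h
  haveI : Fintype {w : HeightOneSpectrum (𝓞 (κ.layer m)) // w.under (𝓞 K) = v} :=
    @Fintype.ofFinite _ (finite_heightOneSpectrum_under_eq v)
  by_cases hx : (κ σ).toAdd = 0
  · -- `σ ∈ ker κ ≤ Γ_m`: the Frobenius is trivial on `K_m`, so there are `[K_m : K] = p^m` places
    have hrange := range_absGaloisRestrict_layer κ m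
    have hN : (absGaloisRestrict K (κ.layer m)).toMonoidHom.range.Normal := by rw [hrange]; infer_instance
    have hI' : 𝔓.inertia (absoluteGaloisGroup K) ≤ (absGaloisRestrict K (κ.layer m)).toMonoidHom.range := by
      rw [hrange]; exact hI.trans (κ.kerSubgroup_le_layerSubgroup m)
    have h := card_placesOver_mul_orderOf_eq_finrank K hN h𝔓 hI' hσ
    have hσm : σ ∈ (absGaloisRestrict K (κ.layer m)).toMonoidHom.range := by
      rw [hrange]
      exact κ.kerSubgroup_le_layerSubgroup m (by rw [ZpExtension.mem_kerSubgroup]; exact toAdd_eq_zero.mp hx)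
    have hord : orderOf (σ : absoluteGaloisGroup K ⧸ (absGaloisRestrict K (κ.layer m)).toMonoidHom.range) = 1 := by
      rw [orderOf_eq_one_iff, ← QuotientGroup.mk_one, QuotientGroup.eq, mul_one]
      exact inv_mem hσm
    rw [hord, mul_one, κ.finrank_layer_holds m, ← Nat.card_eq_fintype_card] at h
    rw [h]
    exact Nat.pow_le_pow_right hprime.pos hcm
  · -- `κ σ = p^{m'} u`, `m' ≥ c`
    set x := (κ σ).toAdd with hxdef
    have hspec := PadicInt.unitCoeff_spec hx
    have hval : c ≤ x.valuation := by
      rw [← PadicInt.mem_span_pow_iff_le_valuation x hx c, Ideal.mem_span_singleton]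
      exact hdvd ⟨σ, hσD⟩
    have hσm : (κ σ).toAdd = (p : ℤ_[p]) ^ x.valuation * (PadicInt.unitCoeff hx : ℤ_[p]) := by
      rw [← hxdef, mul_comm]; exact hspec
    have h := card_placesOver_layer_mul_pow_eq κ m h𝔓 hI hσ (Units.isUnit _) hσm
    -- `p^c · p^{m - m'} ≤ p^m = #· p^{m - m'}`
    have hle : p ^ c * p ^ (m - x.valuation) ≤ p ^ m := by
      rw [← pow_add]
      apply Nat.pow_le_pow_right hprime.pos
      omega
    rw [← h] at hle
    exact Nat.le_of_mul_le_mul_right hle (pow_pos hprime.pos _)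

end Summit.BirchSwinnertonDyer.BirchSwinnertonDyer.Theorems.UniversalToricDescentRelaxedLayerPlaces

end
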